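import Literature.Probability.LatticeModels.LupuCouplingTrifurcation
import HarnessLib

/-!
# Lupu's coupling: almost surely there are not infinitely many infinite clusters

Topic `Literature/Probability/LatticeModels`. Brick 11 of the proof of
`Literature.Probability.LatticeModels.Lupu2016_cableSignClustersBounded` (Lupu 2016, Prop. 5.5):
the Burton–Keane half of Lupu's Lemma 5.3 that the proof needs, for the annealed law `μ̄`
(`annealedLaw`) of Lupu's bond configuration on `ℤ^d`, `d ≥ 3`:

* `jointMeasure_compl_goodSet` — almost every point of the joint space is good (labels in
  `(0,1)`, field nowhere zero: the one-site law is `N(0, G(0))`, `G(0) > 0`);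
* `annealedLaw_cutBall_pos_of_threeSignedInBox_pos` — if three same-sign infinite clusters meet
  `Λ_r` with positive probability then the cut-ball event `T_r(0)` has positive `μ̄`-probability:
  intersect with `{|φ| ≤ t/2 on Λ_r, U ≤ 1 - e^{-t²/2} on ℰ_{Λ_r}}` for `t` large (still positive),
  push forward by the field shift `φ ↦ φ + s t 1_{Λ_r}` (lands in the cut-ball event,
  `symConfig_add_boxShift_mem_cutBall`), and use that this shift is absolutely continuous for the
  free field (`map_add_boxShift_absolutelyContinuous`, Cameron–Martin) — this replaces the
  insertion tolerance / positive finite energy of Gandolfi–Keane–Newman in Lupu's Lemma 5.3;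
* **`annealedLaw_numInfiniteClusters_eq_top`** — `μ̄(N = ∞) = 0`: otherwise some `T_r(0)` has
  probability `a > 0`, hence (translation invariance, `annealedLaw_preimage_shift`) `≥ a` at every
  centre, and the expected number of cut-balls among `(2m+1)^d` disjoint translates in `Λ_n`
  exceeds the deterministic bound `|∂ⁱⁿΛ_{n+1}|` (tree: `card_filter_cutBall_le`, `centres`,
  Bollobás–Riordan 2006, Ch. 5, Thm. 4) for `m` large — verbatim the counting of
  `IsInsertionTolerantErgodic.threeInfClusters_eq_zero`.

References: T. Lupu, Ann. Probab. 44 (2016), Lemma 5.3 [`Lupu2016`]; B. Bollobás, O. Riordan,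
*Percolation* (2006), Ch. 5, Thm. 4 [`BollobasRiordan2006`]; R. Burton, M. Keane, CMP 121 (1989).
-/

noncomputable section

namespace Literature.Probability.LatticeModels

open _root_.MeasureTheory _root_.ProbabilityTheory Finset Filter _root_.Topology
  Literature.Probability.Percolation SimpleGraph
open Percolation (shiftedBox mem_shiftedBox_iff shiftedBox_zero)
open scoped ENNReal NNReal

variable {d : ℕ}

namespace IsDiscreteGFF

variable {ν : Measure (Site d → ℝ)}

/-! ### Good points have full measure -/

/-- A single label lies in a Lebesgue-null subset of `[0,1]` with probability `0`. [folklore] -/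
theorem labelMeasure_eval_mem_eq_zero (e : Sym2 (Site d)) {T : Set ℝ} (hT : MeasurableSet T)
    (h0 : (volume : Measure ℝ) (T ∩ Set.Icc 0 1) = 0) :
    labelMeasure (Site d) {U | U e ∈ T} = 0 := by
  have : IsProbabilityMeasure ((volume : Measure ℝ).restrict (Set.Icc (0 : ℝ) 1)) :=
    isProbabilityMeasure_volume_restrict_unitInterval
  have hmap := Measure.infinitePi_map_eval (fun _ : Sym2 (Site d) =>
    (volume : Measure ℝ).restrict (Set.Icc (0 : ℝ) 1)) e
  have h1 : labelMeasure (Site d) {U | U e ∈ T} =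
      ((labelMeasure (Site d)).map fun U : Labels d => U e) T := by
    rw [Measure.map_apply (measurable_pi_apply e) hT]; rfl
  rw [h1, show labelMeasure (Site d) = Measure.infinitePi (fun _ : Sym2 (Site d) =>
    (volume : Measure ℝ).restrict (Set.Icc (0 : ℝ) 1)) from rfl, hmap, Measure.restrict_apply hT, h0]

/-- Almost every label is positive. [folklore] -/
theorem labelMeasure_eval_nonpos (e : Sym2 (Site d)) : labelMeasure (Site d) {U | U e ≤ 0} = 0 := by
  refine labelMeasure_eval_mem_eq_zero e measurableSet_Iic (measure_mono_null ?_ (measure_singleton 0))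
  rintro u ⟨hu, hu0, -⟩
  exact le_antisymm hu hu0

/-- Almost every label is `< 1`. [folklore] -/
theorem labelMeasure_eval_ge_one (e : Sym2 (Site d)) : labelMeasure (Site d) {U | 1 ≤ U e} = 0 := by
  refine labelMeasure_eval_mem_eq_zero e measurableSet_Ici (measure_mono_null ?_ (measure_singleton 1))
  rintro u ⟨hu, -, hu1⟩
  exact le_antisymm hu1 hu

/-- **The one-site law of the free field has no atom at `0`** (`d ≥ 3`: it is `N(0, G(0))` with
`G(0) = latticeGreen 0 / 2 > 0`). [folklore] -/
theorem measure_coord_eq_zero (hν : IsDiscreteGFF ν (coordProc d)) (hd : 3 ≤ d) (x : Site d) :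
    ν {φ | φ x = 0} = 0 := by
  have hP := hν.1.isProbabilityMeasure
  have hlaw := (hν.1.hasGaussianLaw_eval x).map_eq_gaussianReal
  have hmean : ∫ φ, coordProc d x φ ∂ν = 0 := hν.2.1 x
  have hvar : Var[coordProc d x; ν] = latticeGreen (0 : Site d) / 2 := by
    rw [variance_of_integral_eq_zero (measurable_pi_apply x).aemeasurable hmean]
    have : ∀ φ : Site d → ℝ, coordProc d x φ ^ 2 = φ x * φ x := fun φ => by
      simp [coordProc, sq]
    simp_rw [this, hν.2.2 x x, sub_self]
  have hv : (latticeGreen (0 : Site d) / 2).toNNReal ≠ 0 := by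
    have := latticeGreen_zero_pos d hd
    simp only [ne_eq, Real.toNNReal_eq_zero, not_le]
    linarith
  have hns := nullSingletonClass_gaussianReal (μ := 0) hv
  have h1 : ν {φ | φ x = 0} = (ν.map (coordProc d x)) {0} := by
    rw [Measure.map_apply (measurable_pi_apply x) (measurableSet_singleton 0)]; rfl
  rw [h1, hlaw, hmean, hvar]
  exact measure_singleton 0

/-- **Good points have full measure.** [folklore] -/
theorem jointMeasure_compl_goodSet (hν : IsDiscreteGFF ν (coordProc d)) (hd : 3 ≤ d) :
    jointMeasure ν (goodSet d)ᶜ = 0 := by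
  have hP := hν.1.isProbabilityMeasure
  have := isProbabilityMeasure_labelMeasure (Site d)
  have hsub : (goodSet d)ᶜ ⊆ (⋃ e : Sym2 (Site d), {p : (Site d → ℝ) × Labels d | p.2 e ≤ 0}) ∪
      ⋃ x : Site d, {p : (Site d → ℝ) × Labels d | p.1 x = 0} := by
    intro p hp
    simp only [goodSet, Set.mem_compl_iff, Set.mem_setOf_eq, not_and_or, not_forall, not_lt,
      not_not] at hp
    rcases hp with ⟨e, he⟩ | ⟨x, hx⟩
    · exact Or.inl (Set.mem_iUnion.2 ⟨e, he⟩)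
    · exact Or.inr (Set.mem_iUnion.2 ⟨x, hx⟩)
  refine measure_mono_null hsub (measure_union_null (measure_iUnion_null fun e => ?_)
    (measure_iUnion_null fun x => ?_))
  · have : {p : (Site d → ℝ) × Labels d | p.2 e ≤ 0} = Set.univ ×ˢ {U : Labels d | U e ≤ 0} := by
      ext p; simp
    rw [this, jointMeasure, Measure.prod_prod, labelMeasure_eval_nonpos, mul_zero]
  · have : {p : (Site d → ℝ) × Labels d | p.1 x = 0} = {φ : Site d → ℝ | φ x = 0} ×ˢ Set.univ := by
      ext p; simp
    rw [this, jointMeasure, Measure.prod_prod, hν.measure_coord_eq_zero hd x, zero_mul]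

/-! ### From three same-sign infinite clusters to a cut-ball with positive probability -/

/-- The labels of finitely many bonds are all `< 1` almost surely. [folklore] -/
theorem jointMeasure_exists_label_ge_one (ν : Measure (Site d → ℝ)) [IsProbabilityMeasure ν]
    (F : Finset (Sym2 (Site d))) :
    jointMeasure ν {p : (Site d → ℝ) × Labels d | ∃ e ∈ F, 1 ≤ p.2 e} = 0 := by
  have := isProbabilityMeasure_labelMeasure (Site d)
  have hsub : {p : (Site d → ℝ) × Labels d | ∃ e ∈ F, 1 ≤ p.2 e} ⊆
      ⋃ e ∈ F, (Set.univ ×ˢ {U : Labels d | 1 ≤ U e}) := by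
    rintro p ⟨e, he, h⟩
    exact Set.mem_biUnion he (by simp [h])
  refine measure_mono_null hsub ((measure_biUnion_null_iff F.countable_toSet).2 fun e _ => ?_)
  rw [jointMeasure, Measure.prod_prod, labelMeasure_eval_ge_one, mul_zero]

/-- **Positive probability of a same-sign triple meeting `Λ_r` gives a cut-ball with positive
probability** (`d ≥ 3`, `s = ±1`): Cameron–Martin in place of insertion tolerance. [cite: Lupu2016, Lemma 5.3] -/
theorem annealedLaw_cutBall_pos_of_threeSignedInBox_pos (hν : IsDiscreteGFF ν (coordProc d))
    (hd : 3 ≤ d) {s : ℝ} (hs : s = 1 ∨ s = -1) {r : ℕ}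
    (hpos : jointMeasure ν (threeSignedInBox (d := d) s r) ≠ 0) :
    0 < annealedLaw ν (cutBall (0 : Site d) r) := by
  classical
  have hP := hν.1.isProbabilityMeasure
  have := isProbabilityMeasure_labelMeasure (Site d)
  set K : Finset (Site d) := box d r with hK
  -- the good part of the event, with all box labels `< 1`, still has positive measure
  set E : Set ((Site d → ℝ) × Labels d) := threeSignedInBox s r ∩ goodSet d ∩
    {p | ∀ e ∈ edgesIn (zdGraph d) K, p.2 e < 1} with hE
  have hEpos : jointMeasure ν E ≠ 0 := by
    intro hE0
    apply hpos
    have hsub : threeSignedInBox (d := d) s r ⊆ E ∪ ((goodSet d)ᶜ ∪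
        {p : (Site d → ℝ) × Labels d | ∃ e ∈ edgesIn (zdGraph d) K, 1 ≤ p.2 e}) := by
      intro p hp
      by_cases hg : p ∈ goodSet d
      · by_cases hl : ∀ e ∈ edgesIn (zdGraph d) K, p.2 e < 1
        · exact Or.inl ⟨⟨hp, hg⟩, hl⟩
        · push Not at hl
          exact Or.inr (Or.inr hl)
      · exact Or.inr (Or.inl hg)
    exact measure_mono_null hsub (measure_union_null hE0 (measure_union_null
      (hν.jointMeasure_compl_goodSet hd) (jointMeasure_exists_label_ge_one ν _)))
  -- the sets `A_n`: `|φ| ≤ (n+1)/2` on the box and box labels `≤ 1 - exp(-(n+1)²/2)`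
  set A : ℕ → Set ((Site d → ℝ) × Labels d) := fun n =>
    (threeSignedInBox s r ∩ goodSet d) ∩ ({p | ∀ x ∈ K, |p.1 x| ≤ ((n : ℝ) + 1) / 2} ∩
      {p | ∀ e ∈ edgesIn (zdGraph d) K, p.2 e ≤ 1 - Real.exp (-(((n : ℝ) + 1) ^ 2) / 2)}) with hA
  have hcover : E ⊆ ⋃ n, A n := by
    rintro ⟨φ, U⟩ ⟨⟨hp, hg⟩, hl⟩
    have hlin : Tendsto (fun n : ℕ => ((n : ℝ) + 1) / 2) atTop atTop :=
      (tendsto_atTop_add_const_right _ 1 tendsto_natCast_atTop_atTop).atTop_div_const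
        (by norm_num : (0 : ℝ) < 2)
    have hexp : Tendsto (fun n : ℕ => 1 - Real.exp (-(((n : ℝ) + 1) ^ 2) / 2)) atTop (𝓝 1) := by
      have h2 : Tendsto (fun n : ℕ => ((n : ℝ) + 1) ^ 2 / 2) atTop atTop :=
        ((tendsto_pow_atTop two_ne_zero).comp
          (tendsto_atTop_add_const_right _ 1 tendsto_natCast_atTop_atTop)).atTop_div_const
          (by norm_num : (0 : ℝ) < 2)
      have h3 : Tendsto (fun n : ℕ => -(((n : ℝ) + 1) ^ 2) / 2) atTop atBot := by
        have := tendsto_neg_atTop_atBot.comp h2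
        refine this.congr fun n => ?_
        simp only [Function.comp_apply, neg_div]
      have h4 := Real.tendsto_exp_atBot.comp h3
      simpa using tendsto_const_nhds.sub h4
    have h1 : ∀ x ∈ K, ∀ᶠ n : ℕ in atTop, |φ x| ≤ ((n : ℝ) + 1) / 2 := fun x _ =>
      hlin.eventually_ge_atTop _
    have h2 : ∀ e ∈ edgesIn (zdGraph d) K, ∀ᶠ n : ℕ in atTop,
        U e ≤ 1 - Real.exp (-(((n : ℝ) + 1) ^ 2) / 2) := fun e he =>
      hexp.eventually (eventually_ge_nhds (hl e he))
    obtain ⟨n, hn1, hn2⟩ := ((K.eventually_all.2 h1).and ((edgesIn (zdGraph d) K).eventually_all.2 h2)).exists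
    exact Set.mem_iUnion.2 ⟨n, ⟨hp, hg⟩, hn1, hn2⟩
  obtain ⟨n, hn⟩ : ∃ n, jointMeasure ν (A n) ≠ 0 := by
    by_contra hall
    push Not at hall
    exact hEpos (measure_mono_null hcover (measure_iUnion_null hall))
  -- the field shift by `s t` on the box, `t = n + 1`
  set t : ℝ := (n : ℝ) + 1 with ht
  have htpos : 0 < t := by positivity
  set M : (Site d → ℝ) × Labels d → (Site d → ℝ) × Labels d :=
    Prod.map (fun φ => φ + boxShift K (s * t)) id with hM
  have hMmeas : Measurable M := (measurable_add_const _).prodMap measurable_id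
  set B : Set ((Site d → ℝ) × Labels d) := {q | symConfig q.1 q.2 ∈ cutBall (0 : Site d) r} with hB
  have hBmeas : MeasurableSet B := measurable_symConfig (measurableSet_cutBall 0 r)
  have hAB : A n ⊆ M ⁻¹' B := by
    rintro ⟨φ, U⟩ ⟨⟨hthree, hgood⟩, hφ, hU⟩
    change symConfig (φ + boxShift K (s * t)) U ∈ cutBall (0 : Site d) r
    exact symConfig_add_boxShift_mem_cutBall hs htpos hgood hthree hφ hU
  -- Cameron–Martin: the pushed-forward joint measure is absolutely continuous
  have hmapM : (jointMeasure ν).map M = (ν.map fun φ => φ + boxShift K (s * t)).prod (labelMeasure (Site d)) := by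
    rw [jointMeasure, hM, ← Measure.map_prod_map _ _ (measurable_add_const _) measurable_id,
      Measure.map_id]
  have hac : (jointMeasure ν).map M ≪ jointMeasure ν := by
    rw [hmapM, jointMeasure]
    exact (hν.map_add_boxShift_absolutelyContinuous hd K (s * t)).prod Measure.AbsolutelyContinuous.rfl
  have hBpos : jointMeasure ν B ≠ 0 := by
    intro hB0
    apply hn
    refine measure_mono_null hAB ?_
    rw [← Measure.map_apply hMmeas hBmeas]
    exact hac hB0
  rw [annealedLaw, Measure.map_apply measurable_symConfig (measurableSet_cutBall 0 r)]
  exact pos_iff_ne_zero.2 hBpos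

/-! ### The counting argument: `μ̄(N = ∞) = 0` -/

/-- Translation invariance of the cut-ball probability under the annealed law (the inequality
used by the counting argument). [cite: BollobasRiordan2006, Ch. 5, proof of Thm. 4 ((2), p. 107)] -/
theorem annealedLaw_real_cutBall_zero_le (hν : IsDiscreteGFF ν (coordProc d)) (c : Site d) (r : ℕ) :
    (annealedLaw ν).real (cutBall (0 : Site d) r) ≤ (annealedLaw ν).real (cutBall c r) := by
  have hP := hν.1.isProbabilityMeasure
  have hsub : cutBall (0 : Site d) r ⊆
      BondConfig.relabel (sym2Equiv (Site.shift c)) ⁻¹' cutBall c r := by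
    simpa using cutBall_subset_preimage_shift (0 : Site d) c r
  calc (annealedLaw ν).real (cutBall 0 r)
      ≤ (annealedLaw ν).real (BondConfig.relabel (sym2Equiv (Site.shift c)) ⁻¹' cutBall c r) :=
        measureReal_mono hsub
    _ = (annealedLaw ν).real (cutBall c r) := by
        simp only [measureReal_def]
        rw [annealedLaw_preimage_shift hν c (measurableSet_cutBall c r)]

/-- The expected number of cut-balls among the translates is at most `|∂ⁱⁿΛ_{n+1}|` (pointwise bound
`card_filter_cutBall_le` on lattice configurations, which carry `μ̄`). [cite: BollobasRiordan2006, Ch. 5, proof of Thm. 4 (p. 108)] -/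
theorem annealedLaw_sum_cutBall_le (ν : Measure (Site d → ℝ)) [IsProbabilityMeasure ν] (r m : ℕ) :
    ∑ c ∈ centres r m, annealedLaw ν (cutBall c r) ≤
      (innerBoundary (zdGraph d) (box d ((2 * r + 2) * m + r + 1))).card := by
  classical
  set L := innerBoundary (zdGraph d) (box d ((2 * r + 2) * m + r + 1)) with hL
  have h1 : ∑ c ∈ centres r m, annealedLaw ν (cutBall c r) =
      ∫⁻ ω, ∑ c ∈ centres r m, (cutBall c r).indicator 1 ω ∂annealedLaw ν := by
    rw [lintegral_finsetSum _ fun c _ => measurable_one.indicator (measurableSet_cutBall c r)]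
    exact Finset.sum_congr rfl fun c _ => (lintegral_indicator_one (measurableSet_cutBall c r)).symm
  calc ∑ c ∈ centres r m, annealedLaw ν (cutBall c r)
        = ∫⁻ ω, ∑ c ∈ centres r m, (cutBall c r).indicator 1 ω ∂annealedLaw ν := h1
    _ ≤ ∫⁻ _ω, (L.card : ℝ≥0∞) ∂annealedLaw ν := by
        refine lintegral_mono_ae ?_
        filter_upwards [ae_subset_edgeSet_annealedLaw ν] with ω hω
        have hsum : ∑ c ∈ centres r m, (cutBall c r).indicator (1 : BondConfig (Site d) → ℝ≥0∞) ω =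
            (((centres r m).filter fun c => ω ∈ cutBall c r).card : ℝ≥0∞) := by
          simp only [Set.indicator_apply, Pi.one_apply]
          rw [Finset.sum_boole]
        rw [hsum]
        exact_mod_cast card_filter_cutBall_le r m hω
    _ = L.card := by rw [lintegral_const, measure_univ, mul_one]

/-- **`μ̄(N = ∞) = 0` for Lupu's annealed bond law on `ℤ^d`, `d ≥ 3`**: the Burton–Keane
trifurcation bound with same-sign cut-balls. If `N = ∞` had positive probability, three
infinite clusters of a common sign would meet some box with positive probability
(`subset_iUnion_threeSignedInBox_of_numInfiniteClusters_eq_top`), the cut-ball event `T_r(0)`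
would have probability `a > 0` (`annealedLaw_cutBall_pos_of_threeSignedInBox_pos`), hence `≥ a`
at every centre (translation invariance); the expected number of cut-balls among `(2m+1)^d`
disjoint translates in `Λ_n` is then `≥ a (2m+1)^d` but at most
`|∂ⁱⁿΛ_{n+1}| ≤ 2d(2r+3)^{d-1}(2m+1)^{d-1}` — false for `m` large. (Lupu 2016, Lemma 5.3, invokes
uniqueness via Gandolfi–Keane–Newman; this is the part of it that Prop. 5.5 needs.)
[cite: Lupu2016, Lemma 5.3] -/
theorem annealedLaw_numInfiniteClusters_eq_top (hν : IsDiscreteGFF ν (coordProc d)) (hd : 3 ≤ d) :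
    annealedLaw ν {ω | numInfiniteClusters ω = ⊤} = 0 := by
  classical
  have hP := hν.1.isProbabilityMeasure
  have hd1 : 1 ≤ d := by omega
  by_contra hN
  -- some same-sign triple meets some box with positive probability
  have hmeasN : MeasurableSet {ω : BondConfig (Site d) | numInfiniteClusters ω = ⊤} :=
    measurableSet_numInfiniteClusters_eq_top
  set Pinf : Set ((Site d → ℝ) × Labels d) := {p | numInfiniteClusters (symConfig p.1 p.2) = ⊤} with hPinf
  have hPinf : jointMeasure ν Pinf ≠ 0 := by
    rwa [annealedLaw, Measure.map_apply measurable_symConfig hmeasN] at hN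
  have hgood : jointMeasure ν (Pinf ∩ goodSet d) ≠ 0 := by
    intro h0
    apply hPinf
    refine measure_mono_null (fun p hp => ?_) (measure_union_null h0 (hν.jointMeasure_compl_goodSet hd))
    by_cases hg : p ∈ goodSet d
    · exact Or.inl ⟨hp, hg⟩
    · exact Or.inr hg
  obtain ⟨r, hr⟩ : ∃ r : ℕ, jointMeasure ν (threeSignedInBox (d := d) 1 r ∪ threeSignedInBox (-1) r) ≠ 0 := by
    by_contra hall
    push Not at hall
    exact hgood (measure_mono_null subset_iUnion_threeSignedInBox_of_numInfiniteClusters_eq_top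
      (measure_iUnion_null hall))
  obtain ⟨s, hs, hsr⟩ : ∃ s : ℝ, (s = 1 ∨ s = -1) ∧ jointMeasure ν (threeSignedInBox (d := d) s r) ≠ 0 := by
    by_contra hall
    push Not at hall
    exact hr (measure_union_null (hall 1 (Or.inl rfl)) (hall (-1) (Or.inr rfl)))
  -- the cut-ball probability `a > 0`
  have ha0 := hν.annealedLaw_cutBall_pos_of_threeSignedInBox_pos hd hs hsr
  have ha : 0 < (annealedLaw ν).real (cutBall (0 : Site d) r) := by
    rw [measureReal_def, ENNReal.toReal_pos_iff]
    exact ⟨ha0, measure_lt_top _ _⟩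
  set a := (annealedLaw ν).real (cutBall (0 : Site d) r) with ha_def
  -- the counting, verbatim from the Burton–Keane proof of the tree
  set C₀ : ℕ := 2 * d * (2 * r + 3) ^ (d - 1) with hC₀
  obtain ⟨m, hm⟩ := exists_nat_gt ((C₀ : ℝ) / a)
  have hm' : (C₀ : ℝ) < a * (2 * m + 1) := by
    rw [div_lt_iff₀ ha] at hm
    nlinarith
  set n := (2 * r + 2) * m + r with hn
  set L := innerBoundary (zdGraph d) (box d (n + 1)) with hL
  have hlow : ((2 * m + 1 : ℝ)) ^ d * a ≤ ∑ c ∈ centres r m, (annealedLaw ν).real (cutBall c r) := by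
    calc ((2 * m + 1 : ℝ)) ^ d * a = ∑ _c ∈ centres (d := d) r m, a := by
          rw [Finset.sum_const, card_centres, nsmul_eq_mul]; push_cast; ring
      _ ≤ ∑ c ∈ centres r m, (annealedLaw ν).real (cutBall c r) :=
          Finset.sum_le_sum fun c _ => hν.annealedLaw_real_cutBall_zero_le c r
  have hup : ∑ c ∈ centres r m, (annealedLaw ν).real (cutBall c r) ≤ (L.card : ℝ) := by
    have h' := annealedLaw_sum_cutBall_le (d := d) ν r m
    have hsum : ∑ c ∈ centres r m, (annealedLaw ν).real (cutBall c r) =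
        (∑ c ∈ centres r m, annealedLaw ν (cutBall c r)).toReal := by
      rw [ENNReal.toReal_sum fun c _ => measure_ne_top _ _]
      rfl
    rw [hsum]
    have := ENNReal.toReal_mono (ENNReal.natCast_ne_top L.card) h'
    simpa using this
  have hLcard : (L.card : ℝ) ≤ C₀ * (2 * m + 1 : ℝ) ^ (d - 1) := by
    have h1 := card_innerBoundary_box_le (d := d) (n + 1)
    have h2 : 2 * (n + 1) + 1 ≤ (2 * r + 3) * (2 * m + 1) := by
      have : (2 * r + 3) * (2 * m + 1) = 2 * (n + 1) + 1 + 2 * m := by rw [hn]; ring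
      omega
    calc (L.card : ℝ) ≤ ((2 * d * (2 * (n + 1) + 1) ^ (d - 1) : ℕ) : ℝ) := by exact_mod_cast h1
      _ ≤ ((2 * d * ((2 * r + 3) * (2 * m + 1)) ^ (d - 1) : ℕ) : ℝ) := by
          exact_mod_cast Nat.mul_le_mul_left _ (Nat.pow_le_pow_left h2 _)
      _ = C₀ * (2 * m + 1 : ℝ) ^ (d - 1) := by rw [hC₀]; push_cast; rw [mul_pow]; ring
  have hpow : (2 * m + 1 : ℝ) ^ d = (2 * m + 1) * (2 * m + 1) ^ (d - 1) := by
    conv_lhs => rw [← Nat.sub_add_cancel hd1, pow_succ]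
    ring
  have hchain := hlow.trans (hup.trans hLcard)
  rw [hpow] at hchain
  have hposm : (0 : ℝ) < (2 * m + 1) ^ (d - 1) := by positivity
  have key : (2 * m + 1 : ℝ) * a ≤ C₀ := by
    have h' : ((2 * m + 1 : ℝ) * a) * (2 * m + 1) ^ (d - 1) ≤ (C₀ : ℝ) * (2 * m + 1) ^ (d - 1) := by
      linarith [hchain]
    exact le_of_mul_le_mul_right h' hposm
  linarith [key, hm']

end IsDiscreteGFF

end Literature.Probability.LatticeModels
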